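import Literature.NumberTheory.GaloisRepresentations.ContinuousCorestriction
import HarnessLib

/-!
# Transitivity of corestriction on continuous `H¹`: `cor_{H''/H'} ∘ cor_{H'/H} = cor_{H''/H}`
# (`coresLe_comp`), for open subgroups `H ≤ H' ≤ H''` of finite index of a topological group

Complement to `ContinuousCorestriction.lean` (the relative corestriction `coresLe` on the continuous
cochain `H¹` of a topological representation, defined through the transfer with a system of coset
representatives).  Seat `bsd-potss-rkm` (prover, cell `bsd-potss`, item stmt-BirchSwinnertonDyer-19196):
this is the plumbing lemma W1 of the seat's realisation spec — with it, corestricting the `p`-power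
levels of an Euler system (`Kato2004.ZetaBody`, levels `Gal(ℚ̄/ℚ(μ_{p^{n+1}}))`) to the layers
`Gal(ℚ̄/ℚ_n)` of the cyclotomic `ℤ_p`-tower (`CyclotomicZpExtensionLayerProofs`) yields a
NORM-COMPATIBLE family (hypothesis `hcomp` of `Kato2004.IwasawaH1Data.existsUnique_lift_of_isEulerSystem`).

## The proof (Neukirch–Schmidt–Wingberg (1.5.3)–(1.5.6); Serre, *Local Fields* VII §7)

Choose representatives `a` of `H''/H'` and `b` of `H'/H`.  The map `(u, v) ↦ [a(u)·b(v)]` is a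
bijection `H''/H' × H'/H ≃ H''/H` (`CoresComp.prodMk_bijective`), and through it
`c([a(u) b(v)]) := a(u) b(v)` is a system of representatives of `H''/H` (`CoresComp.compRep`,
`compRep_spec`).  For `g ∈ H''` one has `g·[a(u)b(v)] = [a(gu)·b(η_u v)]` with the Schreier element
`η_u = a(gu)⁻¹ g a(u) ∈ H'` (`smul_prodMk`), hence the Schreier element of `c` at `[a(u)b(v)]` equals
the Schreier element of `b` at `(η_u, v)` (`schreierElt_compRep_coe`).  The transfer formula
`(cor_s f)(g) = Σ_x s(gx)·f(s(gx)⁻¹ g s(x))` (`transferFun`) for `c` therefore coincides TERMWISE,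
after reindexing by the bijection, with the iterated formula for `a` and `b` — so the two cocycles are
EQUAL (not merely cohomologous) for these representatives (`coresLe_comp`; independence of the
representatives is `coresWith_eq_coresWith` inside `coresLe_oneCocycleClass`).

Contents: `CoresComp.prodMk` (+ `_injective`, `_surjective`, `_bijective`), `CoresComp.compRep`
(+ `compRep_prodMk`, `compRep_spec`), `CoresComp.smul_prodMk`, `CoresComp.schreierElt_compRep_coe`,
`transferCocycle_pullback_apply` (values of the cocycle of `coresLe_oneCocycleClass`), `coresLe_comp`.
No new definitions of mathematical objects (the two `def`s are the auxiliary coset map and composite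
representatives), no named facts, no `instance`.

References: J. Neukirch, A. Schmidt, K. Wingberg, *Cohomology of Number Fields*, 2nd ed. (2008),
I §5, Prop. (1.5.3)–(1.5.6) (cor, its transitivity and the transfer formula) [NeukirchSchmidtWingberg2008];
J.-P. Serre, *Local Fields* (1979), VII §7–§8 [SerreLocalFields1979]; *Galois Cohomology* (1997),
I §2.4 [SerreGaloisCohomology1997].
-/

noncomputable section

open CategoryTheory

universe u v

namespace Literature.NumberTheory.GaloisRepresentations

open Literature.NumberTheory.EllipticCurves (schreierElt schreierElt_mem schreierElt_coe
  rep_mul_schreierElt schreierElt_mul rep_inv_mul_rep_mem)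

variable {R : Type u} [Ring R] [TopologicalSpace R]
variable {G : Type v} [Group G] [TopologicalSpace G] [IsTopologicalGroup G]

namespace CoresComp

variable {H H' H'' : Subgroup G}

/-- The product coset map `(u, v) ↦ [a(u) b(v)] ∈ H''/H` for representatives `a` of `H''/H'` and
`b` of `H'/H` (auxiliary). [folklore] -/
private def prodMk (h' : H' ≤ H'') (a : H'' ⧸ H'.subgroupOf H'' → H'') (b : H' ⧸ H.subgroupOf H' → H')
    (x : (H'' ⧸ H'.subgroupOf H'') × (H' ⧸ H.subgroupOf H')) : H'' ⧸ H.subgroupOf H'' :=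
  ((a x.1 * Subgroup.inclusion h' (b x.2) : H'') : H'' ⧸ H.subgroupOf H'')

omit [TopologicalSpace G] [IsTopologicalGroup G] in
/-- Two elements of `H''` with congruent-mod-`H` values have the same `H'`-coset. [folklore] -/
private theorem mk_eq_mk_of_inv_mul_mem (h : H ≤ H') {x y : H''} (hxy : ((x : G)⁻¹ * y) ∈ H) :
    (x : H'' ⧸ H'.subgroupOf H'') = y := by
  rw [QuotientGroup.eq, Subgroup.mem_subgroupOf]
  exact h (by simpa using hxy)

omit [TopologicalSpace G] [IsTopologicalGroup G] in
/-- `(u, v) ↦ [a(u) b(v)]` is injective. [folklore] -/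
private theorem prodMk_injective (h : H ≤ H') (h' : H' ≤ H'')
    {a : H'' ⧸ H'.subgroupOf H'' → H''} (ha : ∀ u, (a u : H'' ⧸ H'.subgroupOf H'') = u)
    {b : H' ⧸ H.subgroupOf H' → H'} (hb : ∀ v, (b v : H' ⧸ H.subgroupOf H') = v) :
    Function.Injective (prodMk h' a b) := by
  rintro ⟨u, v⟩ ⟨u', v'⟩ hE
  simp only [prodMk] at hE
  rw [QuotientGroup.eq, Subgroup.mem_subgroupOf] at hE
  -- `hE : ((a u * b v)⁻¹ * (a u' * b v') : G) ∈ H`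
  have hE' : ((a u : G) * (b v : G))⁻¹ * ((a u' : G) * (b v' : G)) ∈ H := by
    simpa using hE
  -- first the `H'`-cosets agree
  have hu : u = u' := by
    rw [← ha u, ← ha u']
    apply mk_eq_mk_of_inv_mul_mem (H := H') le_rfl
    · have h1 : ((a u : G))⁻¹ * (a u' : G) =
          (b v : G) * ((((a u : G) * (b v : G))⁻¹ * ((a u' : G) * (b v' : G))) * (b v' : G)⁻¹) := by
        group
      rw [h1]
      exact H'.mul_mem (b v).2 (H'.mul_mem (h hE') (H'.inv_mem (b v').2))
  subst hu
  have hv : v = v' := by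
    rw [← hb v, ← hb v', QuotientGroup.eq, Subgroup.mem_subgroupOf]
    have h1 : (((b v)⁻¹ * b v' : H') : G) = ((a u : G) * (b v : G))⁻¹ * ((a u : G) * (b v' : G)) := by
      push_cast
      group
    rw [h1]
    exact hE'
  rw [hv]

omit [TopologicalSpace G] [IsTopologicalGroup G] in
/-- `(u, v) ↦ [a(u) b(v)]` is surjective. [folklore] -/
private theorem prodMk_surjective (h' : H' ≤ H'')
    {a : H'' ⧸ H'.subgroupOf H'' → H''} (ha : ∀ u, (a u : H'' ⧸ H'.subgroupOf H'') = u)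
    {b : H' ⧸ H.subgroupOf H' → H'} (hb : ∀ v, (b v : H' ⧸ H.subgroupOf H') = v) :
    Function.Surjective (prodMk (H := H) h' a b) := by
  intro x
  induction x using QuotientGroup.induction_on with
  | H w =>
    set u : H'' ⧸ H'.subgroupOf H'' := (w : H'' ⧸ H'.subgroupOf H'') with hu
    have ht : ((a u : G))⁻¹ * (w : G) ∈ H' := by
      have := QuotientGroup.eq.mp (ha u)
      rw [Subgroup.mem_subgroupOf] at this
      simpa using this
    set t : H' := ⟨((a u : G))⁻¹ * (w : G), ht⟩ with ht'
    refine ⟨(u, (t : H' ⧸ H.subgroupOf H')), ?_⟩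
    simp only [prodMk]
    rw [QuotientGroup.eq, Subgroup.mem_subgroupOf]
    have hbt : ((b (t : H' ⧸ H.subgroupOf H') : G))⁻¹ * (t : G) ∈ H := by
      have := QuotientGroup.eq.mp (hb (t : H' ⧸ H.subgroupOf H'))
      rw [Subgroup.mem_subgroupOf] at this
      simpa using this
    have h1 : (((a u * Subgroup.inclusion h' (b (t : H' ⧸ H.subgroupOf H')))⁻¹ * w : H'') : G) =
        ((b (t : H' ⧸ H.subgroupOf H') : G))⁻¹ * (((a u : G))⁻¹ * (w : G)) := by
      push_cast
      simp only [Subgroup.coe_inclusion]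
      group
    rw [h1]
    exact hbt

omit [TopologicalSpace G] [IsTopologicalGroup G] in
/-- `(u, v) ↦ [a(u) b(v)]` is a bijection `H''/H' × H'/H ≃ H''/H`. [folklore] -/
private theorem prodMk_bijective (h : H ≤ H') (h' : H' ≤ H'')
    {a : H'' ⧸ H'.subgroupOf H'' → H''} (ha : ∀ u, (a u : H'' ⧸ H'.subgroupOf H'') = u)
    {b : H' ⧸ H.subgroupOf H' → H'} (hb : ∀ v, (b v : H' ⧸ H.subgroupOf H') = v) :
    Function.Bijective (prodMk h' a b) :=
  ⟨prodMk_injective h h' ha hb, prodMk_surjective h' ha hb⟩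

/-- The COMPOSITE representatives `c([a(u) b(v)]) = a(u) b(v)` of `H''/H` (auxiliary; NSW (1.5.6)).
[folklore] -/
private def compRep (h : H ≤ H') (h' : H' ≤ H'')
    {a : H'' ⧸ H'.subgroupOf H'' → H''} (ha : ∀ u, (a u : H'' ⧸ H'.subgroupOf H'') = u)
    {b : H' ⧸ H.subgroupOf H' → H'} (hb : ∀ v, (b v : H' ⧸ H.subgroupOf H') = v)
    (x : H'' ⧸ H.subgroupOf H'') : H'' :=
  a ((Equiv.ofBijective _ (prodMk_bijective h h' ha hb)).symm x).1 *
    Subgroup.inclusion h' (b ((Equiv.ofBijective _ (prodMk_bijective h h' ha hb)).symm x).2)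

omit [TopologicalSpace G] [IsTopologicalGroup G] in
/-- `c([a(u) b(v)]) = a(u) b(v)`. [folklore] -/
private theorem compRep_prodMk (h : H ≤ H') (h' : H' ≤ H'')
    {a : H'' ⧸ H'.subgroupOf H'' → H''} (ha : ∀ u, (a u : H'' ⧸ H'.subgroupOf H'') = u)
    {b : H' ⧸ H.subgroupOf H' → H'} (hb : ∀ v, (b v : H' ⧸ H.subgroupOf H') = v)
    (u : H'' ⧸ H'.subgroupOf H'') (v : H' ⧸ H.subgroupOf H') :
    compRep h h' ha hb (prodMk h' a b (u, v)) = a u * Subgroup.inclusion h' (b v) := by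
  unfold compRep
  have : (Equiv.ofBijective _ (prodMk_bijective h h' ha hb)).symm (prodMk h' a b (u, v)) = (u, v) :=
    (Equiv.ofBijective _ (prodMk_bijective h h' ha hb)).symm_apply_apply (u, v)
  rw [this]

omit [TopologicalSpace G] [IsTopologicalGroup G] in
/-- The composite representatives represent. [folklore] -/
private theorem compRep_spec (h : H ≤ H') (h' : H' ≤ H'')
    {a : H'' ⧸ H'.subgroupOf H'' → H''} (ha : ∀ u, (a u : H'' ⧸ H'.subgroupOf H'') = u)
    {b : H' ⧸ H.subgroupOf H' → H'} (hb : ∀ v, (b v : H' ⧸ H.subgroupOf H') = v)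
    (x : H'' ⧸ H.subgroupOf H'') : (compRep h h' ha hb x : H'' ⧸ H.subgroupOf H'') = x := by
  obtain ⟨⟨u, v⟩, rfl⟩ := prodMk_surjective h' ha hb x
  rw [compRep_prodMk]
  rfl

omit [IsTopologicalGroup G] in
/-- The action of `g ∈ H''` on the product coset: `g · [a(u) b(v)] = [a(g u) b(η_u v)]` with
`η_u = a(g u)⁻¹ g a(u) ∈ H'` the Schreier element. [folklore] -/
private theorem smul_prodMk (h' : H' ≤ H'')
    {a : H'' ⧸ H'.subgroupOf H'' → H''} (ha : ∀ u, (a u : H'' ⧸ H'.subgroupOf H'') = u)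
    {b : H' ⧸ H.subgroupOf H' → H'} (hb : ∀ v, (b v : H' ⧸ H.subgroupOf H') = v)
    (g : H'') (u : H'' ⧸ H'.subgroupOf H'') (v : H' ⧸ H.subgroupOf H') :
    g • prodMk h' a b (u, v) =
      prodMk h' a b (g • u, subgroupOfHom h' (schreierElt (H'.subgroupOf H'') ha g u) • v) := by
  simp only [prodMk]
  rw [MulAction.Quotient.smul_mk, QuotientGroup.eq, Subgroup.mem_subgroupOf]
  have hmem := schreierElt_mem (H.subgroupOf H') hb
    (subgroupOfHom h' (schreierElt (H'.subgroupOf H'') ha g u)) v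
  rw [Subgroup.mem_subgroupOf] at hmem
  convert H.inv_mem hmem using 1
  simp only [smul_eq_mul, subgroupOfHom_apply_coe, schreierElt_coe, Subgroup.coe_mul,
    Subgroup.coe_inv, Subgroup.coe_inclusion]
  group

omit [IsTopologicalGroup G] in
/-- The Schreier element of the composite system at `[a(u) b(v)]` is the Schreier element of `b` at
`(η_u, v)`, as elements of `G`. [folklore] -/
private theorem schreierElt_compRep_coe (h : H ≤ H') (h' : H' ≤ H'')
    {a : H'' ⧸ H'.subgroupOf H'' → H''} (ha : ∀ u, (a u : H'' ⧸ H'.subgroupOf H'') = u)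
    {b : H' ⧸ H.subgroupOf H' → H'} (hb : ∀ v, (b v : H' ⧸ H.subgroupOf H') = v)
    (g : H'') (u : H'' ⧸ H'.subgroupOf H'') (v : H' ⧸ H.subgroupOf H') :
    (((schreierElt (H.subgroupOf H'') (compRep_spec h h' ha hb) g (prodMk h' a b (u, v)) :
        H.subgroupOf H'') : H'') : G) =
      (((schreierElt (H.subgroupOf H') hb (subgroupOfHom h' (schreierElt (H'.subgroupOf H'') ha g u))
        v : H.subgroupOf H') : H') : G) := by
  rw [schreierElt_coe, smul_prodMk h' ha hb, compRep_prodMk, compRep_prodMk, schreierElt_coe]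
  push_cast
  simp only [subgroupOfHom_apply_coe, schreierElt_coe, Subgroup.coe_mul, Subgroup.coe_inv,
    Subgroup.coe_inclusion]
  group


end CoresComp

section Comp

variable (X : TopRep.{v} R G) {H H' H'' : Subgroup G}

/-- Values of the cocycle computing `coresLe` (`coresLe_oneCocycleClass`): for `k ∈ H'`,
`(cor_s φ)(k) = Σ_{v ∈ H'/H} s(k·v) • φ(s(k·v)⁻¹ k s(v))` — the transfer formula on inhomogeneous
1-cochains. [cite: NeukirchSchmidtWingberg2008, I §5 (1.5.6)] -/
theorem transferCocycle_pullback_apply (h : H ≤ H') (hH : IsOpen (H : Set G))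
    [Fintype (H' ⧸ H.subgroupOf H')] {s : H' ⧸ H.subgroupOf H' → H'}
    (hs : ∀ x, (s x : H' ⧸ H.subgroupOf H') = x) (φ : contOneCocycles (subgroupRep X H)) (k : H') :
    (transferCocycle (subgroupRep X H') (H.subgroupOf H') (isOpen_subgroupOf H' hH) hs
        (contOneCocycles.pullback (subgroupOfHom h)
          (Y := subgroupRep (subgroupRep X H') (H.subgroupOf H'))
          (TopRep.ofHom ⟨ContinuousLinearMap.id R X, fun _ => rfl⟩) φ)).1 k =
      ∑ v, X.ρ ((s (k • v) : H') : G)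
        (φ.1 (subgroupOfHom h (schreierElt (H.subgroupOf H') hs k v))) := by
  rw [transferCocycle_apply, transferFun_apply]
  rfl

/-- **Transitivity of corestriction**: for open subgroups `H ≤ H' ≤ H''` of finite index,
`cor_{H''/H'} ∘ cor_{H'/H} = cor_{H''/H}` on `H¹`.  On cocycles, with representatives `a` of
`H''/H'`, `b` of `H'/H` and the COMPOSITE representatives `c([a(u)b(v)]) = a(u) b(v)` of `H''/H`, the
two transfers agree termwise under the bijection `H''/H' × H'/H ≃ H''/H`, `(u,v) ↦ [a(u) b(v)]`
(Neukirch–Schmidt–Wingberg, *Cohomology of Number Fields* (2008), Prop. 1.5.3 (iii); Serre, *Local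
Fields* VII §7). [cite: NeukirchSchmidtWingberg2008, Prop. 1.5.3] -/
theorem coresLe_comp (h : H ≤ H') (h' : H' ≤ H'') (hH : IsOpen (H : Set G))
    (hH' : IsOpen (H' : Set G)) [Fintype (H' ⧸ H.subgroupOf H')]
    [Fintype (H'' ⧸ H'.subgroupOf H'')] [Fintype (H'' ⧸ H.subgroupOf H'')] :
    (coresLe X h' hH') ∘ₗ (coresLe X h hH) = coresLe X (h.trans h') hH := by
  refine LinearMap.ext fun ξ ↦ ?_
  obtain ⟨φ, rfl⟩ := oneCocycleClass_surjective _ ξ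
  -- representatives of `H''/H'` and `H'/H`, and the composite representatives of `H''/H`
  have ha : ∀ u : H'' ⧸ H'.subgroupOf H'', ((Quotient.out u : H'') : H'' ⧸ H'.subgroupOf H'') = u :=
    fun u ↦ QuotientGroup.out_eq' u
  have hb : ∀ v : H' ⧸ H.subgroupOf H', ((Quotient.out v : H') : H' ⧸ H.subgroupOf H') = v :=
    fun v ↦ QuotientGroup.out_eq' v
  have hc := CoresComp.compRep_spec h h' ha hb
  rw [LinearMap.comp_apply, coresLe_oneCocycleClass X h hH hb φ,
    coresLe_oneCocycleClass X h' hH' ha _, coresLe_oneCocycleClass X (h.trans h') hH hc φ]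
  congr 1
  apply Subtype.ext
  ext g
  rw [transferCocycle_pullback_apply X h' hH' ha, transferCocycle_pullback_apply X (h.trans h') hH hc]
  -- reindex the composite transfer by `(u, v) ↦ [a(u) b(v)]`
  conv_rhs => rw [← (Equiv.ofBijective _ (CoresComp.prodMk_bijective h h' ha hb)).sum_comp,
    Fintype.sum_prod_type]
  refine Finset.sum_congr rfl fun u _ ↦ ?_
  rw [transferCocycle_pullback_apply X h hH hb, map_sum]
  refine Finset.sum_congr rfl fun v _ ↦ ?_
  rw [Equiv.ofBijective_apply, CoresComp.smul_prodMk h' ha hb, CoresComp.compRep_prodMk,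
    ← ρ_mul_apply, Subgroup.coe_mul, Subgroup.coe_inclusion]
  -- the arguments of `φ` agree as elements of `H`
  congr 2
  apply Subtype.ext
  rw [subgroupOfHom_apply_coe, subgroupOfHom_apply_coe]
  exact (CoresComp.schreierElt_compRep_coe h h' ha hb g u v).symm

end Comp
end Literature.NumberTheory.GaloisRepresentations

end
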